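import Literature.AlgebraicGeometry.Limits.CofinitePassageOfPieces           -- ★ (o1) `exists_finset_heightOneSpectrum_forall_not_of_pieces`
import Literature.AlgebraicGeometry.AbelianSchemes.PolarizedTupleIsoRebase   -- ★ (G1)(R2) `exists_tupleIso_comp_iff_exists_tupleIso₂`
import Mathlib.AlgebraicGeometry.Morphisms.Separated
import Mathlib.AlgebraicGeometry.Noetherian
import HarnessLib

/-!
# SPECIAL INJECTIVITY OFF A FINITE SET OF PRIMES from GENERIC INJECTIVITY and the finite-type `Isom`-pieces, for ONE global PEL tuple

Topic `AlgebraicGeometry/AbelianSchemes`; namespace `Literature.AlgebraicGeometry.AbelianSchemes.AbelianSchemeOver` (§2–§3) and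
`Literature.AlgebraicGeometry.Limits` (§1).  THEOREMS ONLY (no definition, no instance, no notation, no named fact, no `sorry`).  Cell `hodgecm-mathlib`
(D-0151), P6 «MOD programme» (crux hLiu418 = stmt-HodgeConjecture-24832, `--supports`, count-neutral): organ (GS-3) of the P-LINE ED. 2 «GLOBAL SPREAD»
(LEAD F0P6-plan (g3) 01:09:11Z «`inj₀`՚s `Σ_Isom` on ONE global family»; ROAD Σ) — the obligation `PELInj0LawAt` inside `stub_SPREAD`՚s existential.
HC_CM is proved only modulo the printed citations until rung 0 closes; nothing here is about HC.

THE MATHEMATICS ([MumfordFogartyKirwan1994] Ch. 7 §2 Prop. 7.3 and proof of Thm. 7.9: «the `Isom`-scheme of two polarised families with level structure is of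
finite type over the base; if it has no point over the generic point it lies over finitely many primes»; [EGAIV3] (9.2.1)–(9.2.3); [GortzWedhorn2020] Prop. 10.14,
Def. 9.7 with Prop. 9.8 (the diagonal of a separated morphism is a closed immersion)).  Let `q : Y → Spec B` (`B` Dedekind) be quasi-compact, locally of finite
type and SEPARATED, and `(𝒜, ι, Â, 𝒫, λ, lvl)` ONE tuple over `Y` (the global spread family).  Suppose
(PIECES) the locus of geometric points `t` of `Y ×_B Y` at which the two pulled-back tuples `pr₁^*𝒜`, `pr₂^*𝒜` are isomorphic is the union of the images of
finitely many quasi-compact finite-type `Y ×_B Y`-schemes (★ SP3-a2 `isomPieces_finiteType_of_line` ∕ ★ (G2) `exists_isomPieces_of_charts`, output shape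
VERBATIM), and (GENERIC INJECTIVITY) two geometric points `y₁, y₂` of `Y` over the generic point of `Spec B` at which `𝒜` is isomorphic to itself
(`tupleIsoAt y₁ y₂ 𝒜 …`) are EQUAL.  Then there is a FINITE set `S` of nonzero primes such that for every `v ∉ S`, two geometric points `y₁, y₂` of `Y` over
`v` (same structure map to `Spec B`) with `tupleIsoAt y₁ y₂ 𝒜 …` are EQUAL — SPECIAL INJECTIVITY off `Σ_Isom`.
PROOF.  Apply the cofinite passage ★ (o1) on the OPEN COMPLEMENT `W` of the diagonal `Δ ⊆ Y ×_B Y` (closed, `q` separated) to the property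
`Φ u := «𝒜 iso at (u ≫ pr₁, u ≫ pr₂)»`: its pieces are the `Isom`-pieces restricted to `W` (a point of `W` lifting to a piece lifts to the restricted piece,
since it already lies in `W`; the rebase single ↔ iterated pull-back is ★ (R2)); over the generic point `Φ` fails on `W` (generic injectivity forces
`u ≫ pr₁ = u ≫ pr₂`, so `u` factors through `Δ`, absurd in `W`).  READING at `v ∉ S`: if `y₁ ≠ y₂` then the pair point `⟨y₁, y₂⟩` misses `|Δ|` — §1: a field
point of `Y ×_B Y` CENTRED ON `|Δ|` has equal legs (the fibre product `Spec Ω ×_{Y ×_B Y} Y` along `Δ` is a non-empty closed subscheme of `Spec Ω`, hence all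
of it, Mathlib `Scheme.Pullback.exists_preimage_pullback` + `isIso_of_isClosedImmersion_of_surjective`) — so it lies in `W` and `Φ` fails there.

* §1 `eq_of_lift_base_mem_range_diagonal` — legs of a field point of `Y ×_Z Y` centred on the diagonal of a separated `q` are equal; `lift_base_notMem_range_diagonal`.
* §2 `exists_finset_forall_not_tupleIso_compl_diagonal` — the passage on `W = (Y ×_B Y) ∖ Δ`.
* §3 **`exists_finset_forall_eq_of_tupleIsoAt`** — THE HEAD: special injectivity off a finite set of height-one primes, in the ONE-TUPLE-TWO-POINTS currency
  of Defs `tupleIsoAt y₁ y₂ 𝒜 ρ D pol lvl` (UNFOLDED) = the `PELInj0LawAt` ∕ `RGDInputsAt.inj₀` reading.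

## References
* [MumfordFogartyKirwan1994] D. Mumford, J. Fogarty, F. Kirwan, *Geometric Invariant Theory*, 3rd ed. (1994), Ch. 7 §2 Prop. 7.3 (p. 132), Thm. 7.9 (pp. 139–140).
* [EGAIV3] A. Grothendieck, J. Dieudonné, *ÉGA IV₃*, Publ. Math. IHÉS 28 (1966), (9.2.1)–(9.2.3).
* [GortzWedhorn2020] U. Görtz, T. Wedhorn, *Algebraic Geometry I*, 2nd ed. (2020), Def. 9.7 and Prop. 9.8 (p. 231), Prop. 10.14, Section (10.7).
* [RapoportSmithlingZhang2020Diagonal] M. Rapoport, B. Smithling, W. Zhang, Compos. Math. 156 (2020), §4.1 Thm. 4.1 (p. 17).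
-/

set_option autoImplicit false

noncomputable section

-- Mathlib's `Over`/pull-back API is stated across semireducible wrappers (as in the ★ `AbelianSchemes/*` files).
set_option backward.isDefEq.respectTransparency false

universe u

open CategoryTheory CategoryTheory.Limits AlgebraicGeometry TopologicalSpace
open scoped MonObj

/-! ### §1 Field points of `Y ×_Z Y` centred on the diagonal have equal legs -/

namespace Literature.AlgebraicGeometry.Limits

/-- **A field-valued point of `Y ×_Z Y` CENTRED ON THE DIAGONAL HAS EQUAL LEGS** (`q : Y → Z` separated): if `⟨y₁, y₂⟩ : Spec Ω → Y ×_Z Y` sends the point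
of `Spec Ω` into the image of `Δ : Y → Y ×_Z Y`, then `y₁ = y₂` — the fibre product `Spec Ω ×_{Y ×_Z Y} Y` along `Δ` is NON-EMPTY (Mathlib
`Scheme.Pullback.exists_preimage_pullback`) and a closed subscheme of the reduced one-point scheme `Spec Ω`, hence ALL of it (Mathlib
`isIso_of_isClosedImmersion_of_surjective`), so `⟨y₁, y₂⟩` factors through `Δ`. [cite: GortzWedhorn2020, Definition 9.7 and Proposition 9.8 (p. 231)] -/
theorem eq_of_lift_base_mem_range_diagonal {Y Z : Scheme.{u}} (q : Y ⟶ Z) [IsSeparated q] {Ω : Type u} [Field Ω]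
    (y₁ y₂ : Spec (CommRingCat.of Ω) ⟶ Y) (h : y₁ ≫ q = y₂ ≫ q)
    (hmem : (pullback.lift y₁ y₂ h).base (IsLocalRing.closedPoint Ω) ∈ Set.range (pullback.diagonal q).base) : y₁ = y₂ := by
  obtain ⟨y, hy⟩ := hmem
  set t := pullback.lift y₁ y₂ h with ht
  -- the fibre product of `t` and `Δ` is non-empty …
  obtain ⟨z, hz, -⟩ := Scheme.Pullback.exists_preimage_pullback (f := t) (g := pullback.diagonal q) (IsLocalRing.closedPoint Ω) y hy.symm
  -- … so the closed immersion `Spec Ω ×_{Y ×_Z Y} Y → Spec Ω` is surjective, hence an isomorphism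
  haveI : Surjective (pullback.fst t (pullback.diagonal q)) := ⟨fun x => by
    obtain rfl : x = IsLocalRing.closedPoint Ω := Subsingleton.elim _ _
    exact ⟨z, hz⟩⟩
  haveI : IsIso (pullback.fst t (pullback.diagonal q)) := isIso_of_isClosedImmersion_of_surjective _
  -- hence `t` factors through the diagonal
  have hfac : t = inv (pullback.fst t (pullback.diagonal q)) ≫ pullback.snd t (pullback.diagonal q) ≫ pullback.diagonal q := by
    rw [← pullback.condition, IsIso.inv_hom_id_assoc]
  have h₁ : y₁ = inv (pullback.fst t (pullback.diagonal q)) ≫ pullback.snd t (pullback.diagonal q) := by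
    have := congrArg (· ≫ pullback.fst q q) hfac
    simpa only [ht, pullback.lift_fst, Category.assoc, pullback.diagonal_fst, Category.comp_id] using this
  have h₂ : y₂ = inv (pullback.fst t (pullback.diagonal q)) ≫ pullback.snd t (pullback.diagonal q) := by
    have := congrArg (· ≫ pullback.snd q q) hfac
    simpa only [ht, pullback.lift_snd, Category.assoc, pullback.diagonal_snd, Category.comp_id] using this
  rw [h₁, h₂]

/-- Contrapositive reading: **distinct legs ⇒ the pair point MISSES the diagonal** (lies in the open complement `(Y ×_Z Y) ∖ Δ`).
[cite: GortzWedhorn2020, Definition 9.7 and Proposition 9.8 (p. 231)] -/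
theorem lift_base_notMem_range_diagonal {Y Z : Scheme.{u}} (q : Y ⟶ Z) [IsSeparated q] {Ω : Type u} [Field Ω]
    (y₁ y₂ : Spec (CommRingCat.of Ω) ⟶ Y) (h : y₁ ≫ q = y₂ ≫ q) (hne : y₁ ≠ y₂) :
    (pullback.lift y₁ y₂ h).base (IsLocalRing.closedPoint Ω) ∉ Set.range (pullback.diagonal q).base :=
  fun hmem => hne (eq_of_lift_base_mem_range_diagonal q y₁ y₂ h hmem)

/-- Easy direction: **equal legs ⇒ the pair point lies ON the diagonal** (`⟨y, y⟩ = y ≫ Δ`). [cite: GortzWedhorn2020, Definition 9.7 (p. 231)] -/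
theorem lift_base_mem_range_diagonal_of_eq {Y Z : Scheme.{u}} (q : Y ⟶ Z) {Ω : Type u} [Field Ω]
    (y₁ y₂ : Spec (CommRingCat.of Ω) ⟶ Y) (h : y₁ ≫ q = y₂ ≫ q) (heq : y₁ = y₂) :
    (pullback.lift y₁ y₂ h).base (IsLocalRing.closedPoint Ω) ∈ Set.range (pullback.diagonal q).base := by
  subst heq
  refine ⟨y₁.base (IsLocalRing.closedPoint Ω), ?_⟩
  have : pullback.lift y₁ y₁ h = y₁ ≫ pullback.diagonal q := by
    apply pullback.hom_ext <;> simp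
  rw [this, Scheme.Hom.comp_apply]

end Literature.AlgebraicGeometry.Limits

namespace Literature.AlgebraicGeometry.AbelianSchemes

namespace AbelianSchemeOver

open Literature.AlgebraicGeometry.Limits

/-! ### §2 The cofinite passage on the open complement of the diagonal -/

section Passage

variable {B : Type u} [CommRing B] [IsDedekindDomain B] {Y : Scheme.{u}} (q : Y ⟶ Spec (CommRingCat.of B))
  [QuasiCompact q] [LocallyOfFiniteType q] [IsSeparated q]
  (𝒜 : AbelianSchemeOver Y) {O : Type*} [CommRing O] (ρ : RingAction O 𝒜) (D : 𝒜.DualPair) (pol : 𝒜.Polarization D)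
  {g N : ℕ} (lvl : 𝒜.LevelStructure g N)

/-- **SPECIAL INJECTIVITY OFF A FINITE SET OF PRIMES (HEAD, (GS-3))** — ONE tuple `(𝒜, ι, Â, 𝒫, λ, lvl)` over `q : Y → Spec B` (`B` Dedekind; `q` quasi-compact,
locally of finite type, separated).  HYPOTHESES: (PIECES) the `Isom`-pieces of the two pull-backs `pr₁^*𝒜`, `pr₂^*𝒜` over `Y ×_B Y` — VERBATIM the output of ★
SP3-a2 `isomPieces_finiteType_of_line` ∕ ★ (G2) `exists_isomPieces_of_charts` for `𝒜₁ := 𝒜.baseChange pr₁`, `𝒜₂ := 𝒜.baseChange pr₂` (two tuples at ONE point);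
(GENERIC INJECTIVITY) `tupleIsoAt y₁ y₂ 𝒜 …` at two geometric points over the generic point forces `y₁ = y₂`.  CONCLUSION: a finite `S` of height-one primes
such that for every `v ∉ S` and all geometric points `y₁ y₂ : Spec Ω → Y` with the same structure map, centred over `v`, `tupleIsoAt y₁ y₂ 𝒜 ρ D pol lvl`
(UNFOLDED: the six clauses along `𝟙 (Spec Ω)` between `𝒜 ×_{Y,y₁} Ω` and `𝒜 ×_{Y,y₂} Ω`) forces `y₁ = y₂` — the `inj₀` law of the P6a spine for ONE global family,
with its own exceptional set `Σ_Isom`. [cite: MumfordFogartyKirwan1994, Ch. 7 §2 Proposition 7.3 (p. 132) and Theorem 7.9 (pp. 139–140)]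
[cite: EGAIV3, (9.2.1)–(9.2.3)] [cite: GortzWedhorn2020, Proposition 10.14; Definition 9.7 and Proposition 9.8 (p. 231)] [cite: RapoportSmithlingZhang2020Diagonal, §4.1 Thm. 4.1 p. 17] -/
theorem exists_finset_forall_eq_of_tupleIsoAt
    (hpieces : ∃ (r : ℕ) (I : Fin r → Scheme.{u}) (f : ∀ i, I i ⟶ pullback q q) (_ : ∀ i, QuasiCompact (f i))
      (_ : ∀ i, LocallyOfFiniteType (f i)),
      ∀ ⦃Ω : Type u⦄ [Field Ω] [IsAlgClosed Ω] (t : Spec (CommRingCat.of Ω) ⟶ pullback q q),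
        (∃ (G : ((𝒜.baseChange (pullback.fst q q)).baseChange t).X.left ⟶ ((𝒜.baseChange (pullback.snd q q)).baseChange t).X.left)
            (Ĝ : ((D.baseChange (pullback.fst q q)).baseChange t).hat.X.left ⟶ ((D.baseChange (pullback.snd q q)).baseChange t).hat.X.left),
          ((lvl.baseChange (pullback.fst q q)).baseChange t).IsBaseChangeVia ((lvl.baseChange (pullback.snd q q)).baseChange t)
              (𝟙 (Spec (CommRingCat.of Ω))) G ∧
          ((D.baseChange (pullback.fst q q)).baseChange t).hat.IsBaseChangeVia ((D.baseChange (pullback.snd q q)).baseChange t).hat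
              (𝟙 (Spec (CommRingCat.of Ω))) Ĝ ∧
          (∃ (wG : ((𝒜.baseChange (pullback.fst q q)).baseChange t).X.hom ≫ 𝟙 (Spec (CommRingCat.of Ω)) =
                G ≫ ((𝒜.baseChange (pullback.snd q q)).baseChange t).X.hom)
              (wĜ : ((D.baseChange (pullback.fst q q)).baseChange t).hat.X.hom ≫ 𝟙 (Spec (CommRingCat.of Ω)) =
                Ĝ ≫ ((D.baseChange (pullback.snd q q)).baseChange t).hat.X.hom),
            Nonempty ((Scheme.Modules.pullback
              (pullback.map ((𝒜.baseChange (pullback.fst q q)).baseChange t).X.hom ((D.baseChange (pullback.fst q q)).baseChange t).hat.X.hom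
                ((𝒜.baseChange (pullback.snd q q)).baseChange t).X.hom ((D.baseChange (pullback.snd q q)).baseChange t).hat.X.hom
                G Ĝ (𝟙 (Spec (CommRingCat.of Ω))) wG wĜ)).obj ((D.baseChange (pullback.snd q q)).baseChange t).P ≅
              ((D.baseChange (pullback.fst q q)).baseChange t).P)) ∧
          ((pol.baseChange (pullback.fst q q)).baseChange t).lam.left ≫ Ĝ = G ≫ ((pol.baseChange (pullback.snd q q)).baseChange t).lam.left ∧
          ∀ a : O, (baseChangeHom ((ρ.baseChange (pullback.fst q q)).i a) t).left ≫ G =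
            G ≫ (baseChangeHom ((ρ.baseChange (pullback.snd q q)).i a) t).left) ↔
        ∃ (i : Fin r) (s : Spec (CommRingCat.of Ω) ⟶ I i), s ≫ f i = t)
    (hgen : ∀ ⦃Ω : Type u⦄ [Field Ω] [IsAlgClosed Ω] (y₁ y₂ : Spec (CommRingCat.of Ω) ⟶ Y),
      y₁ ≫ q = y₂ ≫ q → (y₁ ≫ q).base (IsLocalRing.closedPoint Ω) = (⊥ : PrimeSpectrum B) →
      (∃ (G : (𝒜.baseChange y₁).X.left ⟶ (𝒜.baseChange y₂).X.left) (Ĝ : (D.baseChange y₁).hat.X.left ⟶ (D.baseChange y₂).hat.X.left),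
        (lvl.baseChange y₁).IsBaseChangeVia (lvl.baseChange y₂) (𝟙 (Spec (CommRingCat.of Ω))) G ∧
        (D.baseChange y₁).hat.IsBaseChangeVia (D.baseChange y₂).hat (𝟙 (Spec (CommRingCat.of Ω))) Ĝ ∧
        (∃ (wG : (𝒜.baseChange y₁).X.hom ≫ 𝟙 (Spec (CommRingCat.of Ω)) = G ≫ (𝒜.baseChange y₂).X.hom)
            (wĜ : (D.baseChange y₁).hat.X.hom ≫ 𝟙 (Spec (CommRingCat.of Ω)) = Ĝ ≫ (D.baseChange y₂).hat.X.hom),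
          Nonempty ((Scheme.Modules.pullback
            (pullback.map (𝒜.baseChange y₁).X.hom (D.baseChange y₁).hat.X.hom (𝒜.baseChange y₂).X.hom (D.baseChange y₂).hat.X.hom
              G Ĝ (𝟙 (Spec (CommRingCat.of Ω))) wG wĜ)).obj (D.baseChange y₂).P ≅ (D.baseChange y₁).P)) ∧
        (pol.baseChange y₁).lam.left ≫ Ĝ = G ≫ (pol.baseChange y₂).lam.left ∧
        ∀ a : O, (baseChangeHom (ρ.i a) y₁).left ≫ G = G ≫ (baseChangeHom (ρ.i a) y₂).left) → y₁ = y₂) :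
    ∃ S : Finset (IsDedekindDomain.HeightOneSpectrum B),
      ∀ (v : IsDedekindDomain.HeightOneSpectrum B), v ∉ S →
        ∀ ⦃Ω : Type u⦄ [Field Ω] [IsAlgClosed Ω] (y₁ y₂ : Spec (CommRingCat.of Ω) ⟶ Y),
          y₁ ≫ q = y₂ ≫ q → (y₁ ≫ q).base (IsLocalRing.closedPoint Ω) = ⟨v.asIdeal, v.isPrime⟩ →
          (∃ (G : (𝒜.baseChange y₁).X.left ⟶ (𝒜.baseChange y₂).X.left) (Ĝ : (D.baseChange y₁).hat.X.left ⟶ (D.baseChange y₂).hat.X.left),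
            (lvl.baseChange y₁).IsBaseChangeVia (lvl.baseChange y₂) (𝟙 (Spec (CommRingCat.of Ω))) G ∧
            (D.baseChange y₁).hat.IsBaseChangeVia (D.baseChange y₂).hat (𝟙 (Spec (CommRingCat.of Ω))) Ĝ ∧
            (∃ (wG : (𝒜.baseChange y₁).X.hom ≫ 𝟙 (Spec (CommRingCat.of Ω)) = G ≫ (𝒜.baseChange y₂).X.hom)
                (wĜ : (D.baseChange y₁).hat.X.hom ≫ 𝟙 (Spec (CommRingCat.of Ω)) = Ĝ ≫ (D.baseChange y₂).hat.X.hom),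
              Nonempty ((Scheme.Modules.pullback
                (pullback.map (𝒜.baseChange y₁).X.hom (D.baseChange y₁).hat.X.hom (𝒜.baseChange y₂).X.hom (D.baseChange y₂).hat.X.hom
                  G Ĝ (𝟙 (Spec (CommRingCat.of Ω))) wG wĜ)).obj (D.baseChange y₂).P ≅ (D.baseChange y₁).P)) ∧
            (pol.baseChange y₁).lam.left ≫ Ĝ = G ≫ (pol.baseChange y₂).lam.left ∧
            ∀ a : O, (baseChangeHom (ρ.i a) y₁).left ≫ G = G ≫ (baseChangeHom (ρ.i a) y₂).left) → y₁ = y₂ := by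
  classical
  -- the base `Y ×_B Y` is locally Noetherian (`q` locally of finite type over the Noetherian `Spec B`)
  haveI : IsLocallyNoetherian Y := LocallyOfFiniteType.isLocallyNoetherian q
  -- the open complement `W` of the (closed) diagonal
  have hΔ : IsClosed (Set.range (pullback.diagonal q).base) := (pullback.diagonal q).isClosedEmbedding.isClosed_range
  let W : (pullback q q).Opens := ⟨(Set.range (pullback.diagonal q).base)ᶜ, hΔ.isOpen_compl⟩
  -- the structure map of `W` and the property `Φ`
  let w : (W : Scheme.{u}) ⟶ Spec (CommRingCat.of B) := W.ι ≫ pullback.fst q q ≫ q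
  obtain ⟨r, I, f, hqc, hlft, hI⟩ := hpieces
  -- the property `Φ` on geometric points of `W`: «`𝒜` is isomorphic at `(u ≫ pr₁, u ≫ pr₂)`»
  let Φ : ∀ ⦃Ω : Type u⦄ [Field Ω] [IsAlgClosed Ω], (Spec (CommRingCat.of Ω) ⟶ (W : Scheme.{u})) → Prop := fun Ω _ _ u =>
    ∃ (G : (𝒜.baseChange ((u ≫ W.ι) ≫ pullback.fst q q)).X.left ⟶ (𝒜.baseChange ((u ≫ W.ι) ≫ pullback.snd q q)).X.left)
      (Ĝ : (D.baseChange ((u ≫ W.ι) ≫ pullback.fst q q)).hat.X.left ⟶ (D.baseChange ((u ≫ W.ι) ≫ pullback.snd q q)).hat.X.left),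
      (lvl.baseChange ((u ≫ W.ι) ≫ pullback.fst q q)).IsBaseChangeVia (lvl.baseChange ((u ≫ W.ι) ≫ pullback.snd q q)) (𝟙 _) G ∧
      (D.baseChange ((u ≫ W.ι) ≫ pullback.fst q q)).hat.IsBaseChangeVia (D.baseChange ((u ≫ W.ι) ≫ pullback.snd q q)).hat (𝟙 _) Ĝ ∧
      (∃ (wG : (𝒜.baseChange ((u ≫ W.ι) ≫ pullback.fst q q)).X.hom ≫ 𝟙 _ = G ≫ (𝒜.baseChange ((u ≫ W.ι) ≫ pullback.snd q q)).X.hom)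
          (wĜ : (D.baseChange ((u ≫ W.ι) ≫ pullback.fst q q)).hat.X.hom ≫ 𝟙 _ = Ĝ ≫ (D.baseChange ((u ≫ W.ι) ≫ pullback.snd q q)).hat.X.hom),
        Nonempty ((Scheme.Modules.pullback
          (pullback.map (𝒜.baseChange ((u ≫ W.ι) ≫ pullback.fst q q)).X.hom (D.baseChange ((u ≫ W.ι) ≫ pullback.fst q q)).hat.X.hom
            (𝒜.baseChange ((u ≫ W.ι) ≫ pullback.snd q q)).X.hom (D.baseChange ((u ≫ W.ι) ≫ pullback.snd q q)).hat.X.hom G Ĝ (𝟙 _) wG wĜ)).obj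
            (D.baseChange ((u ≫ W.ι) ≫ pullback.snd q q)).P ≅ (D.baseChange ((u ≫ W.ι) ≫ pullback.fst q q)).P)) ∧
      (pol.baseChange ((u ≫ W.ι) ≫ pullback.fst q q)).lam.left ≫ Ĝ = G ≫ (pol.baseChange ((u ≫ W.ι) ≫ pullback.snd q q)).lam.left ∧
      ∀ a : O, (baseChangeHom (ρ.i a) ((u ≫ W.ι) ≫ pullback.fst q q)).left ≫ G =
        G ≫ (baseChangeHom (ρ.i a) ((u ≫ W.ι) ≫ pullback.snd q q)).left
  -- (PIECES) on `W`: rebase single ↔ iterated pull-back (★ (R2)) and lift to the restricted piece (the point already lies in `W`)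
  have hP : ∃ (n : ℕ) (I' : Fin n → Scheme.{u}) (m : ∀ i, I' i ⟶ (W : Scheme.{u})) (_ : ∀ i, QuasiCompact (m i))
      (_ : ∀ i, LocallyOfFiniteType (m i)),
      ∀ ⦃Ω : Type u⦄ [Field Ω] [IsAlgClosed Ω] (u : Spec (CommRingCat.of Ω) ⟶ (W : Scheme.{u})),
        Φ u ↔ ∃ (i : Fin n) (s : Spec (CommRingCat.of Ω) ⟶ I' i), s ≫ m i = u := by
    refine ⟨r, fun i => pullback (f i) W.ι, fun i => pullback.snd (f i) W.ι, fun i => inferInstance, fun i => inferInstance, ?_⟩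
    intro Ω _ _ u
    change (∃ G Ĝ, _) ↔ _
    rw [exists_tupleIso_comp_iff_exists_tupleIso₂ 𝒜 ρ D pol lvl (pullback.fst q q) (pullback.snd q q) (u ≫ W.ι), hI (u ≫ W.ι)]
    constructor
    · rintro ⟨i, s, hs⟩
      exact ⟨i, pullback.lift s u hs, pullback.lift_snd _ _ _⟩
    · rintro ⟨i, s, hs⟩
      exact ⟨i, s ≫ pullback.fst (f i) W.ι, by rw [Category.assoc, pullback.condition, ← Category.assoc, hs]⟩
  -- (GENERIC) on `W`: generic injectivity forces equal legs, i.e. a point ON the diagonal — absurd in `W`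
  have hG : ∀ ⦃Ω : Type u⦄ [Field Ω] [IsAlgClosed Ω] (u : Spec (CommRingCat.of Ω) ⟶ (W : Scheme.{u})),
      (u ≫ w).base (IsLocalRing.closedPoint Ω) = (⊥ : PrimeSpectrum B) → ¬ Φ u := by
    intro Ω _ _ u hu hΦ
    have hq : ((u ≫ W.ι) ≫ pullback.fst q q) ≫ q = ((u ≫ W.ι) ≫ pullback.snd q q) ≫ q := by
      simp only [Category.assoc, pullback.condition]
    have heq := hgen _ _ hq (by simpa only [w, Category.assoc] using hu) hΦ
    have hmem := lift_base_mem_range_diagonal_of_eq q _ _ hq heq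
    have hlift : pullback.lift ((u ≫ W.ι) ≫ pullback.fst q q) ((u ≫ W.ι) ≫ pullback.snd q q) hq = u ≫ W.ι := by
      apply pullback.hom_ext <;> simp
    rw [hlift, Scheme.Hom.comp_apply, Scheme.Opens.ι_apply] at hmem
    exact (u.base (IsLocalRing.closedPoint Ω)).2 hmem
  -- THE PASSAGE ★ (o1) on `W`
  obtain ⟨S, hS⟩ := exists_finset_heightOneSpectrum_forall_not_of_pieces w Φ hP hG
  -- READING at a height-one prime `v ∉ S`
  refine ⟨S, fun v hv Ω _ _ y₁ y₂ hq hv₁ hiso => ?_⟩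
  by_contra hne
  -- the pair point misses the diagonal, so it is a point `u` of `W`
  have hnot := lift_base_notMem_range_diagonal q y₁ y₂ hq hne
  have hrange : Set.range (pullback.lift y₁ y₂ hq).base ⊆ Set.range W.ι.base := by
    rintro _ ⟨x, rfl⟩
    obtain rfl : x = IsLocalRing.closedPoint Ω := Subsingleton.elim _ _
    exact ⟨⟨_, hnot⟩, rfl⟩
  let u : Spec (CommRingCat.of Ω) ⟶ (W : Scheme.{u}) := IsOpenImmersion.lift W.ι (pullback.lift y₁ y₂ hq) hrange
  have hu : u ≫ W.ι = pullback.lift y₁ y₂ hq := IsOpenImmersion.lift_fac _ _ _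
  have h₁ : (u ≫ W.ι) ≫ pullback.fst q q = y₁ := by rw [hu, pullback.lift_fst]
  have h₂ : (u ≫ W.ι) ≫ pullback.snd q q = y₂ := by rw [hu, pullback.lift_snd]
  refine hS v hv u ?_ ?_
  · -- `u` lies over `v`
    have : u ≫ w = y₁ ≫ q := by simp only [w, ← Category.assoc, h₁]
    rw [this]
    exact hv₁
  · -- `Φ u`: transport the isomorphism along `h₁`, `h₂`
    change ∃ G Ĝ, _
    rw [h₁, h₂]
    exact hiso

end Passage

end AbelianSchemeOver

end Literature.AlgebraicGeometry.AbelianSchemes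

end
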